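import Summits.QuantumFields.BalabanUV.T4Continuum.Support.CTGaugeSlotDiff

/-!
# T⁴ programme, spine node NE2 (U1a), sub-row Δ3 «NE2-WALK» (T4-DAG `T4-U1a.S-NE2-D3-WALK°`) — THE GAUGE SLOT UNDER CONJUGATION IN
# DIFFERENCE FORM, part 2: the outer factor `c(Z_U) − c(Z_1)` and the unit-layer factor `c(N_U) − c(N_1)` are `O(α + τ)`
# (file E5b of «Δ3-CT-HBD-B4-DIFF»)

NE2 formalisation swarm `b2b-balaban-t4-ne2-formalise-*`, leaf prover 06 (gen 3), supplier item «Δ3-CT-HBD-B4-DIFF» file E5b (E5a =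
`Support/CTGaugeSlotDiff`).  One level `n`, family `(R, T)` vs the free family `(1, 1)`, weights as in E1–E5a:
 * §3 **`opNorm_conjMat_GDH_diff_le`**: `‖c(G′_UD_Uᴴ) − c(G′_1D_1ᴴ)‖ ≤ dGDc` (row B4's `opNorm_inv_mul_DH_sub_le` transported under conjugation:
   `G′_UD_Uᴴ − G′_1D_1ᴴ = G′_UWᴴ − [G′_UD_Uᴴ·W·G′_1D_1ᴴ + G′_UWᴴ·D_1G′_1D_1ᴴ + G′_U(Y_U − Y_1)·G′_1D_1ᴴ]`, every factor `n`-uniform by E1);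
 * §4 **`opNorm_conjMat_Zdiff_le`**, **`opNorm_conjMat_ZHdiff_le`**: `‖c(Z_U) − c(Z_1)‖, ‖c(Z_Uᴴ) − c(Z_1ᴴ)‖ ≤ dZc = e^{|κ|}τ·K₂(U) + e^{|κ|}·dGDc`;
 * §5 **`opNorm_conjMat_gramKdiff_le`** (`‖c(K_U) − c(K_1)‖ ≤ dKc`) and **`opNorm_conjMat_Ndiff_le`**: with the two unit data
   (`Coercive σU K_U`, `Coercive σ1 K_1`) and `deltaKU < σ`, `‖c(N_U) − c(N_1)‖ ≤ (σU − deltaKU_U)⁻¹·dKc·(σ1 − deltaKU_1)⁻¹`.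
Every constant carries a factor `α` or `τ`: the differences VANISH with the background.

HONEST FRAMING (T4-DAG p. 1).  Bookkeeping over landed modules ([folklore]); statements and constants OURS; MODEL level (no B0); the unit data are
displayed here (E3 ∕ E4 prove them); the assembly and the `t = 1` END are file E5c; Δ3 NOT closed; NE2 (U1a) NOT PROVED; spine PROVED 0/9 unchanged;
NOT infinite volume, NOT a mass gap, NOT the Clay problem, NOT summit progress.  HONEST DEPENDENCY: continuum YM on T⁴ ⇐ BetaPertH ∧ nine spine
estimates (0/9 proved); BetaPertH ⇐ (D1) ∧ (D4) ∧ CAP+tail; G-an2-4 gates asym, D1 and NE2/3/4.  ABSOLUTE RULE kept; no `sorry`.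
-/

noncomputable section

open scoped BigOperators ComplexConjugate Matrix Matrix.Norms.L2Operator Kronecker ComplexOrder

namespace Summit.QuantumFields.BalabanUV.T4Continuum.CTGaugeSlotDiff

open Literature.MathematicalPhysics.QuantumFieldTheory.Balaban1983to89.B5Prop11Plancherel (Tor fine unitVec)
open Literature.MathematicalPhysics.QuantumFieldTheory.Balaban1983to89.B5Action121 (GradOp)
open Literature.MathematicalPhysics.QuantumFieldTheory.Balaban1983to89.B5Blocks16 (blockOf)
open Summit.QuantumFields.BalabanUV.T4Continuum
open Summit.QuantumFields.BalabanUV.T4Continuum.CoerciveInverseTower (Coercive isUnit_of_coercive)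
open Summit.QuantumFields.BalabanUV.T4Continuum.BlockMultiplication (siteMul siteMul_one)
open Summit.QuantumFields.BalabanUV.T4Continuum.GaugeTermDecomposition (covGrad defect covGrad_eq covGrad_one)
open Summit.QuantumFields.BalabanUV.T4Continuum.GaugeTermSandwichBound (Zop Nop)
open Summit.QuantumFields.BalabanUV.T4Continuum.GaugeTermResolventBounds (inv_sub_inv_eq' gram_sub_gram)
open Summit.QuantumFields.BalabanUV.T4Continuum.GaugeTermTwoLevelNumbers (opNorm_mul_sub_mul_le)
open Summit.QuantumFields.BalabanUV.T4Continuum.ScalarCovariantLaplacian (scalarOp connS Bs)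
open Summit.QuantumFields.BalabanUV.T4Continuum.ScalarCovariantCoercive (gammaU siteW Jcov Jcov_nonneg isUnit_scalarOp)
open Summit.QuantumFields.BalabanUV.T4Continuum.CTWeightedCoercivity
open Summit.QuantumFields.BalabanUV.T4Continuum.CTConjugationPieces (conjMat_conjTranspose conjMat_inv coercive_conjMat)
open Summit.QuantumFields.BalabanUV.T4Continuum.CTWeightedEnergy (K1 K2 K1_nonneg K2_nonneg)
open Summit.QuantumFields.BalabanUV.T4Continuum.CTConjugatedHbd (conjMat_neg)
open Summit.QuantumFields.BalabanUV.T4Continuum.CTCovariantScalarGreen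
open Summit.QuantumFields.BalabanUV.T4Continuum.CTGaugeSandwichHbd
open Summit.QuantumFields.BalabanUV.T4Continuum.CTGaugeUnitFactorHbd (deltaKU opNorm_conjMat_gramK_sub_le)

variable {d : ℕ} (n : ℕ) [NeZero n] (M : Fin d → ℕ) [hM : ∀ μ, NeZero (M μ)]
variable {o : Type*} [Fintype o] [DecidableEq o]
variable {ρ₀ : Tor (fine n M) → ℝ} {κ a' : ℝ}
variable {R : Fin d → (Tor (fine n M) → Matrix o o ℂ)} {T : Tor (fine n M) → Matrix o o ℂ} {α τ σU σ1 : ℝ}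

/-! ## §3 The conjugated difference of the outer Green factors `G′D_Rᴴ` -/

/-- the bound of `‖c(G′_UD_Uᴴ) − c(G′_1D_1ᴴ)‖`: `dGDc = γ_U⁻¹·w + K₂(U)·w·K₂(1) + γ_U⁻¹·w·(K₁(1) + cR₁K₂(1)) + γ_U⁻¹·y·K₂(1)`
(`w = dαe^{|κ|}`, `y = a′e^{|κ|}τ(2+τ)`). [folklore] -/
def dGDc (co d : ℕ) (a' α τ κ : ℝ) : ℝ :=
  (gammaU d a' α τ - Jcov co d a' α τ κ)⁻¹ * (d * α * Real.exp |κ|)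
    + (K2 (gammaU d a' α τ - Jcov co d a' α τ κ) (Jcov co d a' α τ κ) (cR d α κ) * (d * α * Real.exp |κ|)
        * K2 (gammaU d a' 0 0 - Jcov co d a' 0 0 κ) (Jcov co d a' 0 0 κ) (cR d 0 κ)
      + (gammaU d a' α τ - Jcov co d a' α τ κ)⁻¹ * (d * α * Real.exp |κ|)
        * (K1 (gammaU d a' 0 0 - Jcov co d a' 0 0 κ) (Jcov co d a' 0 0 κ) (cR d 0 κ)
            + cR d 0 κ * K2 (gammaU d a' 0 0 - Jcov co d a' 0 0 κ) (Jcov co d a' 0 0 κ) (cR d 0 κ))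
      + (gammaU d a' α τ - Jcov co d a' α τ κ)⁻¹ * (a' * Real.exp |κ| * τ * (2 + τ))
        * K2 (gammaU d a' 0 0 - Jcov co d a' 0 0 κ) (Jcov co d a' 0 0 κ) (cR d 0 κ))

/-- **`‖c(G′_UD_Uᴴ) − c(G′_1D_1ᴴ)‖ ≤ dGDc`**. [folklore] -/
theorem opNorm_conjMat_GDH_diff_le (ha' : 0 < a') (hα : 0 ≤ α) (hτ : 0 ≤ τ)
    (hR : ∀ μ x, ‖connS (fine n M) ((n : ℕ) : ℂ) R μ x‖ ≤ α) (hT : ∀ x, ‖T x - 1‖ ≤ τ)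
    (hlip : ∀ x ν, |ρ₀ (x + unitVec (fine n M) ν) - ρ₀ x| ≤ 1 / n) (hosc : ∀ x x', blockOf n M x = blockOf n M x' → |ρ₀ x - ρ₀ x'| ≤ 1)
    (hγU : 0 < gammaU d a' α τ - Jcov (Fintype.card o) d a' α τ κ) (hγ1 : 0 < gammaU d a' 0 0 - Jcov (Fintype.card o) d a' 0 0 κ) :
    ‖conjMat κ (siteW n M ρ₀) (bondCW n M (o := o) ρ₀) ((scalarOp n M a' R T)⁻¹ * (covGrad (fine n M) ((n : ℕ) : ℂ) R)ᴴ)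
        - conjMat κ (siteW n M ρ₀) (bondCW n M (o := o) ρ₀)
            ((scalarOp n M a' (fun _ _ => (1 : Matrix o o ℂ)) (fun _ => 1))⁻¹
              * (covGrad (fine n M) ((n : ℕ) : ℂ) (fun (_ : Fin d) (_ : Tor (fine n M)) => (1 : Matrix o o ℂ)))ᴴ)‖
      ≤ dGDc (Fintype.card o) d a' α τ κ := by
  set Su := scalarOp n M a' R T with hSu
  set S₁ := scalarOp n M a' (fun _ _ => (1 : Matrix o o ℂ)) (fun _ => 1) with hS₁
  set DU := covGrad (fine n M) ((n : ℕ) : ℂ) R with hDU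
  set D₁ := covGrad (fine n M) ((n : ℕ) : ℂ) (fun (_ : Fin d) (_ : Tor (fine n M)) => (1 : Matrix o o ℂ)) with hD₁
  set W := defect (fine n M) ((n : ℕ) : ℂ) R with hW
  set Yu := (a' : ℂ) • ((Bs o n M * siteMul T)ᴴ * (Bs o n M * siteMul T)) with hYu
  set Y₁ := (a' : ℂ) • ((Bs o n M * siteMul (fun _ : Tor (fine n M) => (1 : Matrix o o ℂ)))ᴴ
    * (Bs o n M * siteMul (fun _ : Tor (fine n M) => (1 : Matrix o o ℂ)))) with hY₁
  set ρS := siteW n M (o := o) ρ₀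
  set ρB := bondCW n M (o := o) ρ₀
  have h0R : ∀ μ x, ‖connS (fine n M) ((n : ℕ) : ℂ) (fun (_ : Fin d) (_ : Tor (fine n M)) => (1 : Matrix o o ℂ)) μ x‖ ≤ 0 :=
    fun μ x => by simp [connS]
  have h0T : ∀ x : Tor (fine n M), ‖(fun _ : Tor (fine n M) => (1 : Matrix o o ℂ)) x - 1‖ ≤ 0 := fun x => by simp
  have hD₁G : D₁ = GradOp (fine n M) ((n : ℕ) : ℂ) ⊗ₖ (1 : Matrix o o ℂ) := covGrad_one _ _
  have hDUW : DU = D₁ + W := by rw [hDU, covGrad_eq, hD₁G]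
  have hSug : Su = DUᴴ * DU + Yu := scalarOp_eq_gram n M a' R T
  have hS₁g : S₁ = D₁ᴴ * D₁ + Y₁ := by
    rw [hS₁, scalarOp_eq_gram, siteMul_one, Matrix.mul_one]; rw [hY₁, siteMul_one, Matrix.mul_one]
  have hγU0 : 0 < gammaU d a' α τ := lt_of_lt_of_le hγU (sub_le_self _ (Jcov_nonneg _ _ ha'.le hα κ))
  have hγ10 : 0 < gammaU d a' 0 0 := lt_of_lt_of_le hγ1 (sub_le_self _ (Jcov_nonneg _ _ ha'.le le_rfl κ))
  have hSuU : IsUnit Su.det := (Matrix.isUnit_iff_isUnit_det Su).mp (isUnit_scalarOp n M ha' hα hτ hR hT hγU0)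
  have hS₁U : IsUnit S₁.det := (Matrix.isUnit_iff_isUnit_det S₁).mp (isUnit_scalarOp n M ha' le_rfl le_rfl h0R h0T hγ10)
  -- the identity
  have e1 : Su⁻¹ - S₁⁻¹ = -((Su⁻¹ * DUᴴ) * (W * S₁⁻¹) + (Su⁻¹ * Wᴴ) * (D₁ * S₁⁻¹) + Su⁻¹ * (Yu - Y₁) * S₁⁻¹) := by
    have hd : S₁ - Su = -(DUᴴ * W + Wᴴ * D₁ + (Yu - Y₁)) := by
      rw [← neg_sub, hSug, hS₁g, hDUW, gram_sub_gram]
    rw [inv_sub_inv_eq' hSuU hS₁U, hd]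
    simp only [Matrix.mul_neg, Matrix.neg_mul, Matrix.mul_add, Matrix.add_mul, Matrix.mul_assoc]
  have e2 : Su⁻¹ * DUᴴ - S₁⁻¹ * D₁ᴴ
      = Su⁻¹ * Wᴴ - ((Su⁻¹ * DUᴴ) * (W * (S₁⁻¹ * D₁ᴴ)) + (Su⁻¹ * Wᴴ) * (D₁ * (S₁⁻¹ * D₁ᴴ))
          + (Su⁻¹ * (Yu - Y₁)) * (S₁⁻¹ * D₁ᴴ)) := by
    have h1 : Su⁻¹ * DUᴴ - S₁⁻¹ * D₁ᴴ = Su⁻¹ * Wᴴ + (Su⁻¹ - S₁⁻¹) * D₁ᴴ := by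
      rw [hDUW, Matrix.conjTranspose_add, Matrix.mul_add, Matrix.sub_mul]; abel
    rw [h1, e1]
    simp only [Matrix.neg_mul, Matrix.add_mul, Matrix.mul_assoc]
    abel
  rw [← conjMat_sub, e2, conjMat_sub, conjMat_add, conjMat_add, conjMat_mul κ ρS ρB ρB (Su⁻¹ * DUᴴ), conjMat_mul κ ρB ρS ρB W,
    conjMat_mul κ ρS ρB ρB (Su⁻¹ * Wᴴ), conjMat_mul κ ρS ρS ρB Su⁻¹ Wᴴ, conjMat_mul κ ρB ρS ρB D₁,
    ← conjMat_mul κ ρB ρS ρB D₁ (S₁⁻¹ * D₁ᴴ), conjMat_mul κ ρS ρS ρB (Su⁻¹ * (Yu - Y₁)), conjMat_mul κ ρS ρS ρS Su⁻¹]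
  -- factor bounds
  have hK2U := opNorm_conjMat_inv_covGradH_le n M (ρ₀ := ρ₀) (κ := κ) ha' hα hτ hR hT hlip hosc hγU
  have hK21 := opNorm_conjMat_inv_covGradH_le n M (ρ₀ := ρ₀) (κ := κ) ha' le_rfl le_rfl h0R h0T hlip hosc hγ1
  have hsand1 := opNorm_conjMat_sand_inv_le n M (ρ₀ := ρ₀) (κ := κ) ha' le_rfl le_rfl h0R h0T hlip hosc hγ1
  have hw := opNorm_conjMat_defect_le n M (ρ₀ := ρ₀) (o := o) hα hR hlip κ
  have hwH := opNorm_conjMat_defectH_le n M (ρ₀ := ρ₀) (o := o) hα hR hlip κ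
  have hGU := opNorm_conjMat_scalarOp_inv_le n M (ρ₀ := ρ₀) (κ := κ) ha' hα hτ hR hT hlip hosc hγU
  have hY := opNorm_conjMat_massDiff_le n M (ρ₀ := ρ₀) (o := o) ha'.le κ hτ hosc hT
  have hK2Unn := K2_nonneg (gammaU d a' α τ - Jcov (Fintype.card o) d a' α τ κ) (Jcov (Fintype.card o) d a' α τ κ) (cR d α κ)
  have hK21nn := K2_nonneg (gammaU d a' 0 0 - Jcov (Fintype.card o) d a' 0 0 κ) (Jcov (Fintype.card o) d a' 0 0 κ) (cR d 0 κ)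
  have hsandnn : 0 ≤ K1 (gammaU d a' 0 0 - Jcov (Fintype.card o) d a' 0 0 κ) (Jcov (Fintype.card o) d a' 0 0 κ) (cR d 0 κ)
      + cR d 0 κ * K2 (gammaU d a' 0 0 - Jcov (Fintype.card o) d a' 0 0 κ) (Jcov (Fintype.card o) d a' 0 0 κ) (cR d 0 κ) :=
    (norm_nonneg _).trans hsand1
  have hsandeq : D₁ * (S₁⁻¹ * D₁ᴴ) = GaugeTermDecomposition.sand (fine n M) ((n : ℕ) : ℂ)
      (fun (_ : Fin d) (_ : Tor (fine n M)) => (1 : Matrix o o ℂ)) S₁⁻¹ := by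
    rw [GaugeTermDecomposition.sand, Matrix.mul_assoc]
  rw [hsandeq]
  rw [← hSu, ← hDU] at hK2U
  rw [← hS₁, ← hD₁] at hK21
  rw [← hS₁] at hsand1
  rw [← hW] at hw hwH
  rw [← hSu] at hGU
  rw [← hYu, ← hY₁] at hY
  refine (norm_sub_le _ _).trans ((add_le_add ?_ ((norm_add_le _ _).trans (add_le_add ((norm_add_le _ _).trans (add_le_add ?_ ?_)) ?_))).trans
    (le_of_eq (by rw [dGDc])))
  · exact (Matrix.l2_opNorm_mul _ _).trans (mul_le_mul hGU hwH (norm_nonneg _) (by positivity))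
  · have h0w : 0 ≤ (d : ℝ) * α * Real.exp |κ| := by positivity
    exact ((Matrix.l2_opNorm_mul _ _).trans (mul_le_mul hK2U ((Matrix.l2_opNorm_mul _ _).trans (mul_le_mul hw hK21 (norm_nonneg _) h0w))
      (norm_nonneg _) hK2Unn)).trans (le_of_eq (by ring))
  · exact (Matrix.l2_opNorm_mul _ _).trans (mul_le_mul ((Matrix.l2_opNorm_mul _ _).trans (mul_le_mul hGU hwH (norm_nonneg _)
      (by positivity))) hsand1 (norm_nonneg _) (by positivity))
  · exact (Matrix.l2_opNorm_mul _ _).trans (mul_le_mul ((Matrix.l2_opNorm_mul _ _).trans (mul_le_mul hGU hY (norm_nonneg _)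
      (by positivity))) hK21 (norm_nonneg _) (by positivity))

/-! ## §4 The conjugated difference of the outer factors `Z = Q′G′D_Rᴴ` -/

/-- the bound of `‖c(Z_U) − c(Z_1)‖`: `dZc = e^{|κ|}τ·K₂(U) + e^{|κ|}·dGDc`. [folklore] -/
def dZc (co d : ℕ) (a' α τ κ : ℝ) : ℝ :=
  Real.exp |κ| * τ * K2 (gammaU d a' α τ - Jcov co d a' α τ κ) (Jcov co d a' α τ κ) (cR d α κ) + Real.exp |κ| * dGDc co d a' α τ κ

omit [NeZero n] hM in
/-- `dGDc` is even in the rate. [folklore] -/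
theorem dGDc_neg (co d : ℕ) (a' α τ κ : ℝ) : dGDc co d a' α τ (-κ) = dGDc co d a' α τ κ := by
  simp only [dGDc, Jcov_neg, cR_neg, abs_neg]

omit [NeZero n] hM in
/-- `dZc` is even in the rate. [folklore] -/
theorem dZc_neg (co d : ℕ) (a' α τ κ : ℝ) : dZc co d a' α τ (-κ) = dZc co d a' α τ κ := by
  simp only [dZc, dGDc_neg, Jcov_neg, cR_neg, abs_neg]

/-- **`‖c(Z_U) − c(Z_1)‖ ≤ dZc`** (`Z_U − Z_1 = (Q′_U − Q′_1)·G′_UD_Uᴴ + Q′_1·(G′_UD_Uᴴ − G′_1D_1ᴴ)`). [folklore] -/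
theorem opNorm_conjMat_Zdiff_le (ha' : 0 < a') (hα : 0 ≤ α) (hτ : 0 ≤ τ)
    (hR : ∀ μ x, ‖connS (fine n M) ((n : ℕ) : ℂ) R μ x‖ ≤ α) (hT : ∀ x, ‖T x - 1‖ ≤ τ)
    (hlip : ∀ x ν, |ρ₀ (x + unitVec (fine n M) ν) - ρ₀ x| ≤ 1 / n) (hosc : ∀ x x', blockOf n M x = blockOf n M x' → |ρ₀ x - ρ₀ x'| ≤ 1)
    (hγU : 0 < gammaU d a' α τ - Jcov (Fintype.card o) d a' α τ κ) (hγ1 : 0 < gammaU d a' 0 0 - Jcov (Fintype.card o) d a' 0 0 κ) :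
    ‖conjMat κ (coarseCW n M (o := o) ρ₀) (bondCW n M (o := o) ρ₀)
        (Zop (fine n M) ((n : ℕ) : ℂ) R (scalarOp n M a' R T)⁻¹ (Bs o n M * siteMul T))
      - conjMat κ (coarseCW n M (o := o) ρ₀) (bondCW n M (o := o) ρ₀)
        (Zop (fine n M) ((n : ℕ) : ℂ) (fun (_ : Fin d) (_ : Tor (fine n M)) => (1 : Matrix o o ℂ))
          (scalarOp n M a' (fun _ _ => (1 : Matrix o o ℂ)) (fun _ => 1))⁻¹ (Bs o n M * siteMul (fun _ : Tor (fine n M) => (1 : Matrix o o ℂ))))‖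
      ≤ dZc (Fintype.card o) d a' α τ κ := by
  have eZ : ∀ (Rf : Fin d → (Tor (fine n M) → Matrix o o ℂ)) (Tf : Tor (fine n M) → Matrix o o ℂ),
      conjMat κ (coarseCW n M (o := o) ρ₀) (bondCW n M (o := o) ρ₀)
        (Zop (fine n M) ((n : ℕ) : ℂ) Rf (scalarOp n M a' Rf Tf)⁻¹ (Bs o n M * siteMul Tf))
      = conjMat κ (coarseCW n M (o := o) ρ₀) (siteW n M ρ₀) (Bs o n M * siteMul Tf)
        * conjMat κ (siteW n M ρ₀) (bondCW n M (o := o) ρ₀) ((scalarOp n M a' Rf Tf)⁻¹ * (covGrad (fine n M) ((n : ℕ) : ℂ) Rf)ᴴ) := by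
    intro Rf Tf
    rw [Zop, Matrix.mul_assoc (Bs o n M * siteMul Tf), conjMat_mul κ _ (siteW n M ρ₀) _]
  rw [eZ, eZ]
  have h0T : ∀ x : Tor (fine n M), ‖(fun _ : Tor (fine n M) => (1 : Matrix o o ℂ)) x - 1‖ ≤ 0 := fun x => by simp
  have hQ := opNorm_conjMat_Qu_sub_Q1_le n M (ρ₀ := ρ₀) (o := o) κ hτ hosc hT
  have hQ1 := opNorm_conjMat_Qu_le n M (ρ₀ := ρ₀) (o := o) κ zero_le_one le_rfl hosc h0T
  rw [mul_one, add_zero, mul_one] at hQ1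
  have hK2U := opNorm_conjMat_inv_covGradH_le n M (ρ₀ := ρ₀) (κ := κ) ha' hα hτ hR hT hlip hosc hγU
  have hGD := opNorm_conjMat_GDH_diff_le n M (ρ₀ := ρ₀) (κ := κ) ha' hα hτ hR hT hlip hosc hγU hγ1
  have hE : 0 ≤ Real.exp |κ| := (Real.exp_pos _).le
  refine (opNorm_mul_sub_mul_le _ _ _ _).trans ((add_le_add (mul_le_mul hQ hK2U (norm_nonneg _) (by positivity))
    (mul_le_mul hQ1 hGD (norm_nonneg _) hE)).trans (le_of_eq (by rw [dZc])))

/-- the adjoint: **`‖c(Z_Uᴴ) − c(Z_1ᴴ)‖ ≤ dZc`** (evenness in `κ`). [folklore] -/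
theorem opNorm_conjMat_ZHdiff_le (ha' : 0 < a') (hα : 0 ≤ α) (hτ : 0 ≤ τ)
    (hR : ∀ μ x, ‖connS (fine n M) ((n : ℕ) : ℂ) R μ x‖ ≤ α) (hT : ∀ x, ‖T x - 1‖ ≤ τ)
    (hlip : ∀ x ν, |ρ₀ (x + unitVec (fine n M) ν) - ρ₀ x| ≤ 1 / n) (hosc : ∀ x x', blockOf n M x = blockOf n M x' → |ρ₀ x - ρ₀ x'| ≤ 1)
    (hγU : 0 < gammaU d a' α τ - Jcov (Fintype.card o) d a' α τ κ) (hγ1 : 0 < gammaU d a' 0 0 - Jcov (Fintype.card o) d a' 0 0 κ) :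
    ‖conjMat κ (bondCW n M (o := o) ρ₀) (coarseCW n M (o := o) ρ₀)
        (Zop (fine n M) ((n : ℕ) : ℂ) R (scalarOp n M a' R T)⁻¹ (Bs o n M * siteMul T))ᴴ
      - conjMat κ (bondCW n M (o := o) ρ₀) (coarseCW n M (o := o) ρ₀)
        (Zop (fine n M) ((n : ℕ) : ℂ) (fun (_ : Fin d) (_ : Tor (fine n M)) => (1 : Matrix o o ℂ))
          (scalarOp n M a' (fun _ _ => (1 : Matrix o o ℂ)) (fun _ => 1))⁻¹ (Bs o n M * siteMul (fun _ : Tor (fine n M) => (1 : Matrix o o ℂ))))ᴴ‖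
      ≤ dZc (Fintype.card o) d a' α τ κ := by
  rw [conjMat_conjTranspose, conjMat_conjTranspose, ← Matrix.conjTranspose_sub, Matrix.l2_opNorm_conjTranspose]
  have hγU' : 0 < gammaU d a' α τ - Jcov (Fintype.card o) d a' α τ (-κ) := by rwa [Jcov_neg]
  have hγ1' : 0 < gammaU d a' 0 0 - Jcov (Fintype.card o) d a' 0 0 (-κ) := by rwa [Jcov_neg]
  have h := opNorm_conjMat_Zdiff_le n M (ρ₀ := ρ₀) ha' hα hτ hR hT hlip hosc hγU' hγ1'
  rwa [dZc_neg] at h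

/-! ## §5 The conjugated difference of the unit-layer factors -/

/-- the bound of `‖c(K_U) − c(K_1)‖` (`K = (Q′G′)(G′Q′ᴴ)`): with `dA = e^{|κ|}τ·γ_U⁻¹ + e^{|κ|}·dGc`, `dB = dGc·e^{|κ|}(1+τ) + γ₁⁻¹·e^{|κ|}τ`:
`dKc = dA·(γ_U⁻¹e^{|κ|}(1+τ)) + (e^{|κ|}γ₁⁻¹)·dB`. [folklore] -/
def dKc (co d : ℕ) (a' α τ κ : ℝ) : ℝ :=
  (Real.exp |κ| * τ * (gammaU d a' α τ - Jcov co d a' α τ κ)⁻¹ + Real.exp |κ| * dGc co d a' α τ κ)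
      * ((gammaU d a' α τ - Jcov co d a' α τ κ)⁻¹ * (Real.exp |κ| * (1 + τ)))
    + (Real.exp |κ| * (gammaU d a' 0 0 - Jcov co d a' 0 0 κ)⁻¹)
      * (dGc co d a' α τ κ * (Real.exp |κ| * (1 + τ)) + (gammaU d a' 0 0 - Jcov co d a' 0 0 κ)⁻¹ * (Real.exp |κ| * τ))

/-- **`‖c(K_U) − c(K_1)‖ ≤ dKc`**. [folklore] -/
theorem opNorm_conjMat_gramKdiff_le (ha' : 0 < a') (hα : 0 ≤ α) (hτ : 0 ≤ τ)
    (hR : ∀ μ x, ‖connS (fine n M) ((n : ℕ) : ℂ) R μ x‖ ≤ α) (hT : ∀ x, ‖T x - 1‖ ≤ τ)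
    (hlip : ∀ x ν, |ρ₀ (x + unitVec (fine n M) ν) - ρ₀ x| ≤ 1 / n) (hosc : ∀ x x', blockOf n M x = blockOf n M x' → |ρ₀ x - ρ₀ x'| ≤ 1)
    (hγU : 0 < gammaU d a' α τ - Jcov (Fintype.card o) d a' α τ κ) (hγ1 : 0 < gammaU d a' 0 0 - Jcov (Fintype.card o) d a' 0 0 κ) :
    ‖conjMat κ (coarseCW n M (o := o) ρ₀) (coarseCW n M (o := o) ρ₀)
        ((Bs o n M * siteMul T) * (scalarOp n M a' R T)⁻¹ * (scalarOp n M a' R T)⁻¹ * (Bs o n M * siteMul T)ᴴ)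
      - conjMat κ (coarseCW n M (o := o) ρ₀) (coarseCW n M (o := o) ρ₀)
        ((Bs o n M * siteMul (fun _ : Tor (fine n M) => (1 : Matrix o o ℂ))) * (scalarOp n M a' (fun _ _ => (1 : Matrix o o ℂ)) (fun _ => 1))⁻¹
          * (scalarOp n M a' (fun _ _ => (1 : Matrix o o ℂ)) (fun _ => 1))⁻¹
          * (Bs o n M * siteMul (fun _ : Tor (fine n M) => (1 : Matrix o o ℂ)))ᴴ)‖
      ≤ dKc (Fintype.card o) d a' α τ κ := by
  set Qu := Bs o n M * siteMul T with hQu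
  set Q₁ := Bs o n M * siteMul (fun _ : Tor (fine n M) => (1 : Matrix o o ℂ)) with hQ₁
  set Gu := (scalarOp n M a' R T)⁻¹ with hGu
  set G₁ := (scalarOp n M a' (fun _ _ => (1 : Matrix o o ℂ)) (fun _ => 1))⁻¹ with hG₁
  set σ := coarseCW n M (o := o) ρ₀
  set ρ := siteW n M (o := o) ρ₀
  have h0R : ∀ μ x, ‖connS (fine n M) ((n : ℕ) : ℂ) (fun (_ : Fin d) (_ : Tor (fine n M)) => (1 : Matrix o o ℂ)) μ x‖ ≤ 0 :=
    fun μ x => by simp [connS]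
  have h0T : ∀ x : Tor (fine n M), ‖(fun _ : Tor (fine n M) => (1 : Matrix o o ℂ)) x - 1‖ ≤ 0 := fun x => by simp
  -- factor bounds (conjugated)
  have hQ := opNorm_conjMat_Qu_sub_Q1_le n M (ρ₀ := ρ₀) (o := o) κ hτ hosc hT
  have hQH := opNorm_conjMat_QuH_sub_Q1H_le n M (ρ₀ := ρ₀) (o := o) κ hτ hosc hT
  have hQ1 := opNorm_conjMat_Qu_le n M (ρ₀ := ρ₀) (o := o) κ zero_le_one le_rfl hosc h0T
  have hQuH := opNorm_conjMat_QuH_le n M (ρ₀ := ρ₀) (o := o) κ zero_le_one hτ hosc hT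
  rw [mul_one, add_zero, mul_one] at hQ1
  rw [mul_one] at hQuH
  have hGU := opNorm_conjMat_scalarOp_inv_le n M (ρ₀ := ρ₀) (κ := κ) ha' hα hτ hR hT hlip hosc hγU
  have hG1 := opNorm_conjMat_scalarOp_inv_le n M (ρ₀ := ρ₀) (κ := κ) ha' le_rfl le_rfl h0R h0T hlip hosc hγ1
  have hdG := opNorm_conjMat_green_diff_le n M (ρ₀ := ρ₀) (κ := κ) ha' hα hτ hR hT hlip hosc hγU hγ1
  rw [← hQu, ← hQ₁] at hQ hQH; rw [← hQ₁] at hQ1; rw [← hQu] at hQuH; rw [← hGu] at hGU; rw [← hG₁] at hG1; rw [← hGu, ← hG₁] at hdG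
  have hE : 0 ≤ Real.exp |κ| := (Real.exp_pos _).le
  have hdGnn : 0 ≤ dGc (Fintype.card o) d a' α τ κ := (norm_nonneg _).trans hdG
  -- `A = Q′G′`, `B = G′Q′ᴴ`
  have hA : ‖conjMat κ σ ρ Qu * conjMat κ ρ ρ Gu - conjMat κ σ ρ Q₁ * conjMat κ ρ ρ G₁‖
      ≤ Real.exp |κ| * τ * (gammaU d a' α τ - Jcov (Fintype.card o) d a' α τ κ)⁻¹ + Real.exp |κ| * dGc (Fintype.card o) d a' α τ κ :=
    (opNorm_mul_sub_mul_le _ _ _ _).trans (add_le_add (mul_le_mul hQ hGU (norm_nonneg _) (by positivity))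
      (mul_le_mul hQ1 hdG (norm_nonneg _) hE))
  have hB : ‖conjMat κ ρ ρ Gu * conjMat κ ρ σ Quᴴ - conjMat κ ρ ρ G₁ * conjMat κ ρ σ Q₁ᴴ‖
      ≤ dGc (Fintype.card o) d a' α τ κ * (Real.exp |κ| * (1 + τ)) + (gammaU d a' 0 0 - Jcov (Fintype.card o) d a' 0 0 κ)⁻¹ * (Real.exp |κ| * τ) :=
    (opNorm_mul_sub_mul_le _ _ _ _).trans (add_le_add (mul_le_mul hdG hQuH (norm_nonneg _) hdGnn)
      (mul_le_mul hG1 hQH (norm_nonneg _) (by positivity)))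
  have hBU : ‖conjMat κ ρ ρ Gu * conjMat κ ρ σ Quᴴ‖ ≤ (gammaU d a' α τ - Jcov (Fintype.card o) d a' α τ κ)⁻¹ * (Real.exp |κ| * (1 + τ)) :=
    (Matrix.l2_opNorm_mul _ _).trans (mul_le_mul hGU hQuH (norm_nonneg _) (by positivity))
  have hA1 : ‖conjMat κ σ ρ Q₁ * conjMat κ ρ ρ G₁‖ ≤ Real.exp |κ| * (gammaU d a' 0 0 - Jcov (Fintype.card o) d a' 0 0 κ)⁻¹ :=
    (Matrix.l2_opNorm_mul _ _).trans (mul_le_mul hQ1 hG1 (norm_nonneg _) hE)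
  -- conjugate the two products and telescope
  have e : conjMat κ σ σ (Qu * Gu * Gu * Quᴴ) - conjMat κ σ σ (Q₁ * G₁ * G₁ * Q₁ᴴ)
      = (conjMat κ σ ρ Qu * conjMat κ ρ ρ Gu) * (conjMat κ ρ ρ Gu * conjMat κ ρ σ Quᴴ)
        - (conjMat κ σ ρ Q₁ * conjMat κ ρ ρ G₁) * (conjMat κ ρ ρ G₁ * conjMat κ ρ σ Q₁ᴴ) := by
    rw [show Qu * Gu * Gu * Quᴴ = (Qu * Gu) * (Gu * Quᴴ) by simp only [Matrix.mul_assoc],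
      show Q₁ * G₁ * G₁ * Q₁ᴴ = (Q₁ * G₁) * (G₁ * Q₁ᴴ) by simp only [Matrix.mul_assoc],
      conjMat_mul κ σ ρ σ (Qu * Gu) (Gu * Quᴴ), conjMat_mul κ σ ρ ρ Qu Gu, conjMat_mul κ ρ ρ σ Gu Quᴴ,
      conjMat_mul κ σ ρ σ (Q₁ * G₁) (G₁ * Q₁ᴴ), conjMat_mul κ σ ρ ρ Q₁ G₁, conjMat_mul κ ρ ρ σ G₁ Q₁ᴴ]
  rw [e]
  have hA0 : 0 ≤ Real.exp |κ| * τ * (gammaU d a' α τ - Jcov (Fintype.card o) d a' α τ κ)⁻¹ + Real.exp |κ| * dGc (Fintype.card o) d a' α τ κ :=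
    (norm_nonneg _).trans hA
  refine (opNorm_mul_sub_mul_le _ _ _ _).trans ((add_le_add (mul_le_mul hA hBU (norm_nonneg _) hA0)
    (mul_le_mul hA1 hB (norm_nonneg _) (by positivity))).trans (le_of_eq (by rw [dKc])))

/-- **`‖c(N_U) − c(N_1)‖ ≤ ν_U·dKc·ν_1`** from the two unit data (`(cK_U)⁻¹ − (cK_1)⁻¹ = (cK_U)⁻¹(cK_1 − cK_U)(cK_1)⁻¹`,
`ν = (σK − deltaKU)⁻¹`). [folklore] -/
theorem opNorm_conjMat_Ndiff_le (ha' : 0 < a') (hα : 0 ≤ α) (hτ : 0 ≤ τ)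
    (hR : ∀ μ x, ‖connS (fine n M) ((n : ℕ) : ℂ) R μ x‖ ≤ α) (hT : ∀ x, ‖T x - 1‖ ≤ τ)
    (hlip : ∀ x ν, |ρ₀ (x + unitVec (fine n M) ν) - ρ₀ x| ≤ 1 / n) (hosc : ∀ x x', blockOf n M x = blockOf n M x' → |ρ₀ x - ρ₀ x'| ≤ 1)
    (hγU : 0 < gammaU d a' α τ - Jcov (Fintype.card o) d a' α τ κ) (hγ1 : 0 < gammaU d a' 0 0 - Jcov (Fintype.card o) d a' 0 0 κ)
    (hKU : Coercive σU ((Bs o n M * siteMul T) * (scalarOp n M a' R T)⁻¹ * (scalarOp n M a' R T)⁻¹ * (Bs o n M * siteMul T)ᴴ))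
    (hK1 : Coercive σ1 ((Bs o n M * siteMul (fun _ : Tor (fine n M) => (1 : Matrix o o ℂ)))
      * (scalarOp n M a' (fun _ _ => (1 : Matrix o o ℂ)) (fun _ => 1))⁻¹ * (scalarOp n M a' (fun _ _ => (1 : Matrix o o ℂ)) (fun _ => 1))⁻¹
      * (Bs o n M * siteMul (fun _ : Tor (fine n M) => (1 : Matrix o o ℂ)))ᴴ))
    (hδU : deltaKU (Fintype.card o) d a' α τ κ < σU) (hδ1 : deltaKU (Fintype.card o) d a' 0 0 κ < σ1) :
    ‖conjMat κ (coarseCW n M (o := o) ρ₀) (coarseCW n M (o := o) ρ₀) (Nop (fine n M) (scalarOp n M a' R T)⁻¹ (Bs o n M * siteMul T))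
      - conjMat κ (coarseCW n M (o := o) ρ₀) (coarseCW n M (o := o) ρ₀)
          (Nop (fine n M) (scalarOp n M a' (fun _ _ => (1 : Matrix o o ℂ)) (fun _ => 1))⁻¹
            (Bs o n M * siteMul (fun _ : Tor (fine n M) => (1 : Matrix o o ℂ))))‖
      ≤ (σU - deltaKU (Fintype.card o) d a' α τ κ)⁻¹ * dKc (Fintype.card o) d a' α τ κ * (σ1 - deltaKU (Fintype.card o) d a' 0 0 κ)⁻¹ := by
  have h0R : ∀ μ x, ‖connS (fine n M) ((n : ℕ) : ℂ) (fun (_ : Fin d) (_ : Tor (fine n M)) => (1 : Matrix o o ℂ)) μ x‖ ≤ 0 :=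
    fun μ x => by simp [connS]
  have h0T : ∀ x : Tor (fine n M), ‖(fun _ : Tor (fine n M) => (1 : Matrix o o ℂ)) x - 1‖ ≤ 0 := fun x => by simp
  have hγU0 : 0 < gammaU d a' α τ := lt_of_lt_of_le hγU (sub_le_self _ (Jcov_nonneg _ _ ha'.le hα κ))
  have hγ10 : 0 < gammaU d a' 0 0 := lt_of_lt_of_le hγ1 (sub_le_self _ (Jcov_nonneg _ _ ha'.le le_rfl κ))
  set σ := coarseCW n M (o := o) ρ₀
  set KU := (Bs o n M * siteMul T) * (scalarOp n M a' R T)⁻¹ * (scalarOp n M a' R T)⁻¹ * (Bs o n M * siteMul T)ᴴ with hKUdef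
  set K1 := (Bs o n M * siteMul (fun _ : Tor (fine n M) => (1 : Matrix o o ℂ)))
      * (scalarOp n M a' (fun _ _ => (1 : Matrix o o ℂ)) (fun _ => 1))⁻¹ * (scalarOp n M a' (fun _ _ => (1 : Matrix o o ℂ)) (fun _ => 1))⁻¹
      * (Bs o n M * siteMul (fun _ : Tor (fine n M) => (1 : Matrix o o ℂ)))ᴴ with hK1def
  -- the conjugated Grams are coercive, hence invertible
  have hdU := opNorm_conjMat_gramK_sub_le n M (ρ₀ := ρ₀) (κ := κ) ha' hα hτ hR hT hlip hosc hγU0 hγU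
  have hd1 := opNorm_conjMat_gramK_sub_le n M (ρ₀ := ρ₀) (κ := κ) ha' le_rfl le_rfl h0R h0T hlip hosc hγ10 hγ1
  rw [← hKUdef] at hdU; rw [← hK1def] at hd1
  have hcU := coercive_conjMat hKU κ σ hdU
  have hc1 := coercive_conjMat hK1 κ σ hd1
  have hUunit : IsUnit (conjMat κ σ σ KU).det :=
    (Matrix.isUnit_iff_isUnit_det _).mp (isUnit_of_coercive (sub_pos.mpr hδU) hcU)
  have h1unit : IsUnit (conjMat κ σ σ K1).det :=
    (Matrix.isUnit_iff_isUnit_det _).mp (isUnit_of_coercive (sub_pos.mpr hδ1) hc1)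
  have hNU : ‖(conjMat κ σ σ KU)⁻¹‖ ≤ (σU - deltaKU (Fintype.card o) d a' α τ κ)⁻¹ :=
    CoerciveInverseTower.opNorm_inv_le_of_coercive (sub_pos.mpr hδU) hcU
  have hN1 : ‖(conjMat κ σ σ K1)⁻¹‖ ≤ (σ1 - deltaKU (Fintype.card o) d a' 0 0 κ)⁻¹ :=
    CoerciveInverseTower.opNorm_inv_le_of_coercive (sub_pos.mpr hδ1) hc1
  have hdK := opNorm_conjMat_gramKdiff_le n M (ρ₀ := ρ₀) (κ := κ) ha' hα hτ hR hT hlip hosc hγU hγ1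
  rw [← hKUdef, ← hK1def] at hdK
  rw [Nop, Nop, ← hKUdef, ← hK1def, conjMat_inv, conjMat_inv, inv_sub_inv_eq' hUunit h1unit, ← conjMat_sub, ← neg_sub, conjMat_neg,
    Matrix.mul_neg, Matrix.neg_mul, norm_neg]
  have h0 : 0 ≤ (σU - deltaKU (Fintype.card o) d a' α τ κ)⁻¹ := inv_nonneg.mpr (sub_pos.mpr hδU).le
  calc _ ≤ ‖(conjMat κ σ σ KU)⁻¹ * conjMat κ σ σ (KU - K1)‖ * ‖(conjMat κ σ σ K1)⁻¹‖ := Matrix.l2_opNorm_mul _ _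
    _ ≤ (‖(conjMat κ σ σ KU)⁻¹‖ * ‖conjMat κ σ σ (KU - K1)‖) * ‖(conjMat κ σ σ K1)⁻¹‖ :=
        mul_le_mul_of_nonneg_right (Matrix.l2_opNorm_mul _ _) (norm_nonneg _)
    _ ≤ ((σU - deltaKU (Fintype.card o) d a' α τ κ)⁻¹ * dKc (Fintype.card o) d a' α τ κ) * (σ1 - deltaKU (Fintype.card o) d a' 0 0 κ)⁻¹ := by
        refine mul_le_mul (mul_le_mul hNU ?_ (norm_nonneg _) h0) hN1 (norm_nonneg _) (mul_nonneg h0 ((norm_nonneg _).trans hdK))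
        rw [conjMat_sub]; exact hdK

end Summit.QuantumFields.BalabanUV.T4Continuum.CTGaugeSlotDiff

end
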